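import Literature.Probability.Percolation.FivePointHolomorphyFaces
import HarnessLib

/-!
# Five-point discrete holomorphicity, II: the core decomposition (HT1) and the invariant triples (HT2), for every domain

Topic `Literature/Probability/Percolation`; lane pcv-sawmu (CriticalPhenomena), door (v). Proofs of the faces HT1 `CoreDecomposition`
(pcv-sawmu b-step0 g9: completions of cores biject onto the six-odd-point spaces at the three edges of an interior face — support and
parity by `xorDeg_holds`, the inverse deletes the sides of `v`) and HT2 `InvariantTriples` (pcv-sawmu b-engine-2 g6: the ATTACHMENT
LEMMA `ht2_reach_attach` — in `ζ ∪ {attached sides of v}` a walk either avoids the isolated face `v` or enters and leaves it across two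
attached sides — and «a path component of a core carries at most two odd faces» (`odd_component`): under the HT2 hypothesis the linking
data read by the class predicate are the same for the three completions). Max-degree-two combinatorics only; no planarity.

## References
* M. Khristoforov, S. Smirnov, *Percolation and O(1) loop model*, arXiv:2111.15612 (2021), §1.2 and Lemma 4.
* B. Bollobás, O. Riordan, *Percolation*, Cambridge University Press (2006), Ch. 7 §7.2.2 pp. 168–171.
-/

open Finset

/-! #### HT1 `CoreDecomposition` — proof (b-step0 gen 9) -/

namespace Literature.Probability.Percolation.FivePoint

open Finset Literature.Probability.Percolation Literature.Probability.LatticeModels Literature.Probability.Percolation.FivePoint TriMarkedDomain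

variable (D : TriMarkedDomain 5)

namespace N5

/-- the sides of a face with all vertices in `G` are bonds of `H_G`. [cite: KhristoforovSmirnov2021, Lemma 4 (discrete holomorphicity: the triple bijection at a vertex)] -/
theorem h1_side_mem_hBonds {v : HexVertex} (hv : hexFaceVertices v ⊆ D.verts) (i : Fin 3) : side v i ∈ hBonds D := by
  have h := TriMarkedDomain.adj_faceVertex_succ v (i + 1)
  rw [add_assoc] at h
  exact mem_hBonds D h (Or.inl (hv (faceVertex_mem v _)))

/-- a face is not one of its opposite faces. [cite: KhristoforovSmirnov2021, Lemma 4 (discrete holomorphicity: the triple bijection at a vertex)] -/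
theorem h1_ne_oppFace (v : HexVertex) (i : Fin 3) : v ≠ oppFace v i := (hexGraph_adj_oppFace v i).ne

open Classical in
/-- **parity of a set of sides of `v`**: odd at `v` iff the number of sides is odd; odd at the opposite face across each chosen side;
even elsewhere. [cite: KhristoforovSmirnov2021, Lemma 4 (discrete holomorphicity: the triple bijection at a vertex)] -/
theorem h1_odd_xiDeg_sides {v : HexVertex} (hv : hexFaceVertices v ⊆ D.verts) (I : Finset (Fin 3)) {F : HexVertex}
    (hF : F ∈ triFacesTouching D.verts) :
    Odd (xiDeg (I.image (side v)) F) ↔ ((F = v ∧ Odd I.card) ∨ ∃ i ∈ I, F = oppFace v i) := by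
  induction I using Finset.induction_on with
  | empty =>
    have h0 : xiDeg ((∅ : Finset (Fin 3)).image (side v)) F = 0 := by
      rw [Finset.image_empty, l1_xiDeg_eq, Finset.card_eq_zero, Finset.filter_eq_empty_iff]
      intro j _ hj; exact absurd hj (Finset.notMem_empty _)
    rw [h0]
    simp
  | insert i I hi ih =>
    have hnot : side v i ∉ I.image (side v) := by
      rw [Finset.mem_image]
      rintro ⟨i', hi', he⟩
      exact hi (side_injective v he ▸ hi')
    have hsd : (insert i I).image (side v) = symmDiff {side v i} (I.image (side v)) := by
      rw [Finset.image_insert]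
      ext b
      rw [Finset.mem_insert, Finset.mem_symmDiff, Finset.mem_singleton]
      constructor
      · rintro (rfl | h)
        · exact Or.inl ⟨rfl, hnot⟩
        · exact Or.inr ⟨h, fun e => hnot (e ▸ h)⟩
      · rintro (⟨rfl, -⟩ | ⟨h, -⟩)
        · exact Or.inl rfl
        · exact Or.inr h
    rw [hsd, xorDeg_holds, l1_odd_xiDeg_singleton_iff, l3_exists_side_eq_iff D (h1_side_mem_hBonds D hv i) hF, ih,
      Finset.card_insert_of_notMem hi, Nat.odd_add_one, Finset.exists_mem_insert]
    have hne : v ≠ oppFace v i := h1_ne_oppFace v i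
    have hnoI : ¬ ∃ i' ∈ I, oppFace v i = oppFace v i' := by
      rintro ⟨i', hi', he⟩; exact hi (oppFace_injective' v he ▸ hi')
    have hnov : ¬ ∃ i' ∈ I, v = oppFace v i' := by
      rintro ⟨i', -, he⟩; exact h1_ne_oppFace v i' he
    by_cases hFv : F = v
    · rw [hFv]
      simp [hne, hnov]
    · by_cases hFi : F = oppFace v i
      · rw [hFi]
        simp [hne.symm, hnoI]
      · simp [hFv, hFi]

/-- corner faces, as the finset `corners D`. [cite: KhristoforovSmirnov2021, Lemma 4 (discrete holomorphicity: the triple bijection at a vertex)] -/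
theorem h1_mem_corners_iff (F : HexVertex) : (∃ j : Fin 5, IsCornerFace D j F) ↔ F ∈ corners D := by
  rw [mem_corners]
  constructor
  · rintro ⟨j, hj⟩; exact ⟨j, (isCornerFace_iff_eq_yc D).1 hj⟩
  · rintro ⟨j, hj⟩; exact ⟨j, (isCornerFace_iff_eq_yc D).2 hj⟩

/-- two consecutive labelled vertices of a face are distinct. [cite: KhristoforovSmirnov2021, Lemma 4 (discrete holomorphicity: the triple bijection at a vertex)] -/
theorem h1_fv_ne (v : HexVertex) (i : Fin 3) : faceVertex v (i + 1) ≠ faceVertex v (i + 2) := fun e =>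
  absurd (faceVertex_injective v e) (by rw [add_right_inj]; decide)

/-- the two endpoints of the `i`-th side are vertices of the opposite face. [cite: KhristoforovSmirnov2021, Lemma 4 (discrete holomorphicity: the triple bijection at a vertex)] -/
theorem h1_fv_mem_oppFace (v : HexVertex) (i : Fin 3) :
    faceVertex v (i + 1) ∈ hexFaceVertices (oppFace v i) ∧ faceVertex v (i + 2) ∈ hexFaceVertices (oppFace v i) := by
  have h1 : faceVertex v (i + 1) ∈ faceEdge v (oppFace v i) := by rw [faceEdge_oppFace]; simp
  have h2 : faceVertex v (i + 2) ∈ faceEdge v (oppFace v i) := by rw [faceEdge_oppFace]; simp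
  exact ⟨(Finset.mem_inter.1 (show faceVertex v (i + 1) ∈ hexFaceVertices v ∩ hexFaceVertices (oppFace v i) from h1)).2,
    (Finset.mem_inter.1 (show faceVertex v (i + 2) ∈ hexFaceVertices v ∩ hexFaceVertices (oppFace v i) from h2)).2⟩

/-- an interior face is not a corner face. [cite: KhristoforovSmirnov2021, Lemma 4 (discrete holomorphicity: the triple bijection at a vertex)] -/
theorem h1_v_not_corner {v : HexVertex} (hv : hexFaceVertices v ⊆ D.verts) : v ∉ corners D := by
  rw [not_mem_corners_iff]
  intro i
  exact not_corner_of_two_mem D (faceVertex_mem v (0 + 1)) (faceVertex_mem v (0 + 2)) (hv (faceVertex_mem v _))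
    (hv (faceVertex_mem v _)) (h1_fv_ne v 0) i

/-- the neighbours of an interior face are not corner faces. [cite: KhristoforovSmirnov2021, Lemma 4 (discrete holomorphicity: the triple bijection at a vertex)] -/
theorem h1_opp_not_corner {v : HexVertex} (hv : hexFaceVertices v ⊆ D.verts) (i : Fin 3) : oppFace v i ∉ corners D := by
  rw [not_mem_corners_iff]
  intro j
  obtain ⟨m1, m2⟩ := h1_fv_mem_oppFace v i
  exact not_corner_of_two_mem D m1 m2 (hv (faceVertex_mem v _)) (hv (faceVertex_mem v _)) (h1_fv_ne v i) j

/-- an interior face touches `G`, and so do its neighbours. [cite: KhristoforovSmirnov2021, Lemma 4 (discrete holomorphicity: the triple bijection at a vertex)] -/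
theorem h1_v_touching {v : HexVertex} (hv : hexFaceVertices v ⊆ D.verts) : v ∈ triFacesTouching D.verts :=
  mem_triFacesTouching.2 ⟨_, hv (faceVertex_mem v 0), faceVertex_mem v 0⟩

/-- (H) bookkeeping. [cite: KhristoforovSmirnov2021, Lemma 4 (discrete holomorphicity: the triple bijection at a vertex)] -/
theorem h1_opp_touching {v : HexVertex} (hv : hexFaceVertices v ⊆ D.verts) (i : Fin 3) : oppFace v i ∈ triFacesTouching D.verts :=
  mem_triFacesTouching.2 ⟨_, hv (faceVertex_mem v (i + 1)), (h1_fv_mem_oppFace v i).1⟩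

open Classical in
/-- a core and the sides of `v` are disjoint, so the completion is a symmetric difference. [cite: KhristoforovSmirnov2021, Lemma 4 (discrete holomorphicity: the triple bijection at a vertex)] -/
theorem h1_compl_eq_symmDiff {v : HexVertex} {S : Finset (Fin 3)} {ζ : Finset (Sym2 (Site 2))} (hq : IsCore D v S ζ) (I : Finset (Fin 3)) :
    ζ ∪ I.image (side v) = symmDiff ζ (I.image (side v)) := by
  obtain ⟨-, hside⟩ := ha_core_sub D hq
  ext b
  rw [Finset.mem_union, Finset.mem_symmDiff]
  constructor
  · rintro (h | h)
    · refine Or.inl ⟨h, fun h' => ?_⟩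
      obtain ⟨i, -, rfl⟩ := Finset.mem_image.1 h'
      exact hside i h
    · refine Or.inr ⟨h, fun h' => ?_⟩
      obtain ⟨i, -, rfl⟩ := Finset.mem_image.1 h
      exact hside i h'
  · rintro (⟨h, -⟩ | ⟨h, -⟩)
    · exact Or.inl h
    · exact Or.inr h

open Classical in
/-- **HT1, first half: the completion of a core at `k` lies in the six-odd-point space at the `k`-th edge, with odd endpoint `coreEnd`.** [cite: KhristoforovSmirnov2021, Lemma 4 (discrete holomorphicity: the triple bijection at a vertex)] -/
theorem h1_compl_mem {v : HexVertex} (hv : hexFaceVertices v ⊆ D.verts) (k : Fin 3) (S : Finset (Fin 3))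
    (ζ : Finset (Sym2 (Site 2))) (hq : IsCore D v S ζ) : coreCompl v S k ζ ∈ T6at D v k (coreEnd v S k) := by
  obtain ⟨hζh, hside⟩ := ha_core_sub D hq
  have hodd := hq.2.1
  have hpar := hq.2.2
  unfold T6at loopSpace6 coreCompl
  rw [Finset.mem_filter, Finset.mem_powerset]
  refine ⟨?_, fun F hF => ?_⟩
  · -- support
    intro b hb
    rw [Finset.mem_erase]
    rcases Finset.mem_union.1 hb with h | h
    · exact ⟨fun e => hside k (by rw [← show side v k = s(faceVertex v (k + 1), faceVertex v (k + 2)) from rfl] at e; rw [e] at h; exact h),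
        hζh h⟩
    · obtain ⟨i, hi, rfl⟩ := Finset.mem_image.1 h
      have hik : i ≠ k := (Finset.mem_erase.1 hi).1
      exact ⟨fun e => hik (side_injective v e), h1_side_mem_hBonds D hv i⟩
  · -- parity
    rw [h1_compl_eq_symmDiff D hq, xorDeg_holds, hpar F hF, h1_odd_xiDeg_sides D hv (S.erase k) hF, Finset.mem_union,
      h1_mem_corners_iff]
    have hvc := h1_v_not_corner D hv
    have hvo : ∀ i : Fin 3, v ≠ oppFace v i := h1_ne_oppFace v
    by_cases hFc : F ∈ corners D
    · -- corner: odd in the core, untouched by the sides of `v`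
      have hFv : F ≠ v := fun e => hvc (e ▸ hFc)
      have hFo : ∀ i, F ≠ oppFace v i := fun i e => h1_opp_not_corner D hv i (e ▸ hFc)
      have hno : ¬ ∃ i ∈ S.erase k, F = oppFace v i := fun ⟨i, _, e⟩ => hFo i e
      simp only [hFc, true_or, hFv, false_and, hno, or_false, iff_false, not_not]
    · by_cases hFv : F = v
      · subst hFv
        have hno : ¬ ∃ i ∈ S.erase k, F = oppFace F i := fun ⟨i, _, e⟩ => hvo i e
        have hni : F ∉ S.image (oppFace F) := fun h => by
          obtain ⟨i, -, e⟩ := Finset.mem_image.1 h; exact hvo i e.symm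
        have hend : (F = coreEnd F S k) ↔ k ∉ S := by
          unfold coreEnd; split_ifs with h
          · exact ⟨fun e => absurd e (hvo k), fun h' => absurd h h'⟩
          · exact ⟨fun _ => h, fun _ => rfl⟩
        have hcard : Odd (S.erase k).card ↔ k ∉ S := by
          by_cases hk : k ∈ S
          · rw [Finset.card_erase_of_mem hk]
            obtain ⟨m, hm⟩ := hodd
            rw [hm, Nat.add_sub_cancel]
            exact ⟨fun ho => absurd ho (by rw [Nat.odd_iff]; omega), fun h => absurd hk h⟩
          · rw [Finset.erase_eq_of_notMem hk]; exact ⟨fun _ => hk, fun _ => hodd⟩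
        simp only [hFc, hni, or_self, false_iff, true_and, hno, or_false, not_not, hend, hcard, false_or]
      · by_cases hFo : ∃ i : Fin 3, F = oppFace v i
        · obtain ⟨i, rfl⟩ := hFo
          have hoc := h1_opp_not_corner D hv i
          have him : oppFace v i ∈ S.image (oppFace v) ↔ i ∈ S := by
            rw [Finset.mem_image]
            constructor
            · rintro ⟨i', hi', e⟩; exact oppFace_injective' v e ▸ hi'
            · intro h; exact ⟨i, h, rfl⟩
          have hex : (∃ i' ∈ S.erase k, oppFace v i = oppFace v i') ↔ (i ≠ k ∧ i ∈ S) := by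
            constructor
            · rintro ⟨i', hi', e⟩
              have := oppFace_injective' v e; subst this
              exact Finset.mem_erase.1 hi'
            · intro h; exact ⟨i, Finset.mem_erase.2 h, rfl⟩
          have hend : (oppFace v i = coreEnd v S k) ↔ (k ∈ S ∧ i = k) := by
            unfold coreEnd; split_ifs with h
            · exact ⟨fun e => ⟨h, oppFace_injective' v e⟩, fun e => by rw [e.2]⟩
            · exact ⟨fun e => absurd e.symm (hvo i), fun e => absurd e.1 h⟩
          simp only [hoc, false_or, him, hFv, false_and, hex, hend]
          by_cases hi : i ∈ S <;> by_cases hik : i = k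
          · subst hik; simp [hi]
          · simp [hi, hik]
          · subst hik; simp [hi]
          · simp [hi, hik]
        · have hFo' : ∀ i, F ≠ oppFace v i := fun i e => hFo ⟨i, e⟩
          have hni : F ∉ S.image (oppFace v) := fun h => by
            obtain ⟨i, -, e⟩ := Finset.mem_image.1 h; exact hFo' i e.symm
          have hno : ¬ ∃ i ∈ S.erase k, F = oppFace v i := fun ⟨i, _, e⟩ => hFo' i e
          have hend : F ≠ coreEnd v S k := by
            rcases ha_coreEnd_eq_or v S k with h | h <;> rw [h]
            · exact hFv
            · exact hFo' k
          simp only [hFc, hni, or_self, hFv, false_and, hno, not_true_eq_false, hend]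


open Classical in
/-- a set without sides of `v`, together with some sides of `v`, is a symmetric difference. [cite: KhristoforovSmirnov2021, Lemma 4 (discrete holomorphicity: the triple bijection at a vertex)] -/
theorem h1_union_sides_eq_symmDiff {v : HexVertex} {ζ : Finset (Sym2 (Site 2))} (hside : ∀ j : Fin 3, side v j ∉ ζ) (I : Finset (Fin 3)) :
    ζ ∪ I.image (side v) = symmDiff ζ (I.image (side v)) := by
  ext b
  rw [Finset.mem_union, Finset.mem_symmDiff]
  constructor
  · rintro (h | h)
    · refine Or.inl ⟨h, fun h' => ?_⟩
      obtain ⟨i, -, rfl⟩ := Finset.mem_image.1 h'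
      exact hside i h
    · refine Or.inr ⟨h, fun h' => ?_⟩
      obtain ⟨i, -, rfl⟩ := Finset.mem_image.1 h
      exact hside i h'
  · rintro (⟨h, -⟩ | ⟨h, -⟩)
    · exact Or.inl h
    · exact Or.inr h

open Classical in
/-- the core underlying a configuration: delete the sides of `v`. [cite: KhristoforovSmirnov2021, Lemma 4 (discrete holomorphicity: the triple bijection at a vertex)] -/
noncomputable def coreOf (v : HexVertex) (ξ : Finset (Sym2 (Site 2))) : Finset (Sym2 (Site 2)) :=
  ξ.filter fun b => ∀ j : Fin 3, b ≠ side v j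

open Classical in
/-- the odd-neighbour set of the core underlying a configuration at the `k`-th edge with odd endpoint `s`. [cite: KhristoforovSmirnov2021, Lemma 4 (discrete holomorphicity: the triple bijection at a vertex)] -/
noncomputable def oddSetOf (v : HexVertex) (k : Fin 3) (s : HexVertex) (ξ : Finset (Sym2 (Site 2))) : Finset (Fin 3) :=
  Finset.univ.filter fun i => if i = k then s = oppFace v k else side v i ∈ ξ

open Classical in
/-- **HT1, second half: every configuration at the `k`-th edge has exactly one core preimage.** [cite: KhristoforovSmirnov2021, Lemma 4 (discrete holomorphicity: the triple bijection at a vertex)] -/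
theorem h1_exists_unique {v : HexVertex} (hv : hexFaceVertices v ⊆ D.verts) (k : Fin 3) {s : HexVertex}
    (hs : s ∈ ({v, oppFace v k} : Finset HexVertex)) {ξ : Finset (Sym2 (Site 2))} (hξ : ξ ∈ T6at D v k s) :
    ∃! p : Finset (Fin 3) × Finset (Sym2 (Site 2)), IsCore D v p.1 p.2 ∧ coreEnd v p.1 k = s ∧ coreCompl v p.1 k p.2 = ξ := by
  -- unpack `ξ ∈ T6(s)`
  have hξ' := hξ
  unfold T6at loopSpace6 at hξ'
  rw [Finset.mem_filter, Finset.mem_powerset] at hξ'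
  obtain ⟨hsub, hparξ⟩ := hξ'
  have hξh : ξ ⊆ hBonds D := fun b hb => Finset.mem_of_mem_erase (hsub hb)
  have hk : side v k ∉ ξ := fun h => (Finset.mem_erase.1 (hsub h)).1 rfl
  rw [Finset.mem_insert, Finset.mem_singleton] at hs
  have hvo : ∀ i : Fin 3, v ≠ oppFace v i := h1_ne_oppFace v
  have hvc := h1_v_not_corner D hv
  have hvt := h1_v_touching D hv
  -- the sides of `v` present in `ξ`, the core, the odd-neighbour set (as opaque names with defining equations)
  obtain ⟨R, hR⟩ : ∃ R : Finset (Fin 3), R = Finset.univ.filter fun i => side v i ∈ ξ := ⟨_, rfl⟩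
  obtain ⟨ζ, hζ⟩ : ∃ ζ : Finset (Sym2 (Site 2)), ζ = coreOf v ξ := ⟨_, rfl⟩
  obtain ⟨S, hS⟩ : ∃ S : Finset (Fin 3), S = oddSetOf v k s ξ := ⟨_, rfl⟩
  have hRmem : ∀ i : Fin 3, i ∈ R ↔ side v i ∈ ξ := fun i => by rw [hR, Finset.mem_filter]; simp
  have hζmem : ∀ b, b ∈ ζ ↔ b ∈ ξ ∧ ∀ j : Fin 3, b ≠ side v j := fun b => by rw [hζ]; unfold coreOf; rw [Finset.mem_filter]
  have hkR : k ∉ R := fun h => hk ((hRmem k).1 h)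
  have hζside : ∀ j : Fin 3, side v j ∉ ζ := fun j h => ((hζmem _).1 h).2 j rfl
  have hζsub : ζ ⊆ ξ := fun b hb => ((hζmem b).1 hb).1
  -- ξ = ζ ∆ (sides in ξ)
  have hdec : ξ = ζ ∪ R.image (side v) := by
    ext b
    rw [Finset.mem_union, hζmem, Finset.mem_image]
    constructor
    · intro hb
      by_cases h : ∀ j : Fin 3, b ≠ side v j
      · exact Or.inl ⟨hb, h⟩
      · push Not at h
        obtain ⟨j, rfl⟩ := h
        exact Or.inr ⟨j, (hRmem j).2 hb, rfl⟩
    · rintro (⟨hb, -⟩ | ⟨j, hj, rfl⟩)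
      · exact hb
      · exact (hRmem j).1 hj
  have hsd : ξ = symmDiff ζ (R.image (side v)) := by rw [← h1_union_sides_eq_symmDiff hζside]; exact hdec
  -- parity of `R`: odd iff `s = v`
  have hRodd : Odd R.card ↔ s = v := by
    have h := hparξ v hvt
    rw [l1_xiDeg_eq] at h
    rw [hR, h, h1_mem_corners_iff]
    constructor
    · rintro (hc | e)
      · exact absurd hc hvc
      · exact e.symm
    · intro e; exact Or.inr e.symm
  -- membership in `S`
  have hSk : k ∈ S ↔ s = oppFace v k := by
    rw [hS]; unfold oddSetOf; rw [Finset.mem_filter]; simp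
  have hSi : ∀ i : Fin 3, i ≠ k → (i ∈ S ↔ side v i ∈ ξ) := by
    intro i hik; rw [hS]; unfold oddSetOf; rw [Finset.mem_filter]; simp [hik]
  have hSerase : S.erase k = R := by
    ext i
    rw [Finset.mem_erase, hRmem]
    constructor
    · rintro ⟨hik, hi⟩; exact (hSi i hik).1 hi
    · intro hi
      have hik : i ≠ k := fun e => hk (e ▸ hi)
      exact ⟨hik, (hSi i hik).2 hi⟩
  have hScard : Odd S.card := by
    by_cases hsk : s = oppFace v k
    · have hkS : k ∈ S := hSk.2 hsk
      have : S.card = R.card + 1 := by rw [← Finset.card_erase_add_one hkS, hSerase]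
      rw [this, Nat.odd_add_one, hRodd]
      intro e; exact hvo k (e.symm.trans hsk)
    · have hkS : k ∉ S := fun h => hsk (hSk.1 h)
      have : S = R := by rw [← Finset.erase_eq_of_notMem hkS, hSerase]
      rw [this, hRodd]
      exact hs.resolve_right hsk
  -- the core property
  have hcore : IsCore D v S ζ := by
    refine ⟨?_, hScard, fun F hF => ?_⟩
    · intro b hb
      unfold Eminus
      rw [Finset.mem_filter]
      exact ⟨hξh (hζsub hb), ((hζmem b).1 hb).2⟩
    · -- parity of ζ from ξ = ζ ∆ R-sides
      have hx := xorDeg_holds ζ (R.image (side v)) F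
      rw [← hsd, hparξ F hF, h1_odd_xiDeg_sides D hv R hF, h1_mem_corners_iff] at hx
      rw [Finset.mem_union]
      by_cases hFc : F ∈ corners D
      · have hFv : F ≠ v := fun e => hvc (e ▸ hFc)
        have hFo : ∀ i, F ≠ oppFace v i := fun i e => h1_opp_not_corner D hv i (e ▸ hFc)
        have hno : ¬ ∃ i ∈ R, F = oppFace v i := fun ⟨i, _, e⟩ => hFo i e
        simp only [hFc, true_or, hFv, false_and, hno, or_false, true_iff] at hx ⊢
        tauto
      · by_cases hFv : F = v
        · rw [hFv] at hx ⊢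
          have hno : ¬ ∃ i ∈ R, v = oppFace v i := fun ⟨i, _, e⟩ => hvo i e
          have hni : v ∉ S.image (oppFace v) := fun h => by
            obtain ⟨i, -, e⟩ := Finset.mem_image.1 h; exact hvo i e.symm
          have hzero : ¬ Odd (xiDeg ζ v) := by
            by_cases hsv : s = v
            · intro ho
              apply hx.1 (Or.inr hsv.symm)
              exact ⟨fun _ => Or.inl ⟨rfl, hRodd.2 hsv⟩, fun _ => ho⟩
            · intro ho
              have hnot : ¬ (v ∈ corners D ∨ v = s) := by
                rintro (h | h)
                · exact hvc h
                · exact hsv h.symm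
              apply hnot
              apply hx.2
              intro hiff
              rcases hiff.1 ho with ⟨-, hR'⟩ | hex
              · exact hsv (hRodd.1 hR')
              · exact hno hex
          constructor
          · intro ho; exact absurd ho hzero
          · rintro (h | h)
            · exact absurd h hvc
            · exact absurd h hni
        · by_cases hFo : ∃ i : Fin 3, F = oppFace v i
          · obtain ⟨i, rfl⟩ := hFo
            have hoc := h1_opp_not_corner D hv i
            have him : oppFace v i ∈ S.image (oppFace v) ↔ i ∈ S := by
              rw [Finset.mem_image]
              constructor
              · rintro ⟨i', hi', e⟩; exact oppFace_injective' v e ▸ hi'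
              · intro h; exact ⟨i, h, rfl⟩
            have hex : (∃ i' ∈ R, oppFace v i = oppFace v i') ↔ side v i ∈ ξ := by
              rw [← hRmem]
              constructor
              · rintro ⟨i', hi', e⟩
                have := oppFace_injective' v e; subst this; exact hi'
              · intro h; exact ⟨i, h, rfl⟩
            simp only [hoc, false_or, hFv, false_and, hex, him] at hx ⊢
            by_cases hik : i = k
            · subst hik
              rw [hSk]
              have hsi : (oppFace v i = s) ↔ (s = oppFace v i) := eq_comm
              simp only [hk, iff_false, not_not, hsi] at hx
              exact hx.symm
            · rw [hSi i hik]
              have hne : ¬ oppFace v i = s := by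
                rcases hs with rfl | rfl
                · exact fun e => hvo i e.symm
                · exact fun e => hik (oppFace_injective' v e)
              simp only [hne, false_iff, not_not] at hx
              exact hx
          · have hFo' : ∀ i, F ≠ oppFace v i := fun i e => hFo ⟨i, e⟩
            have hni : F ∉ S.image (oppFace v) := fun h => by
              obtain ⟨i, -, e⟩ := Finset.mem_image.1 h; exact hFo' i e.symm
            have hno : ¬ ∃ i ∈ R, F = oppFace v i := fun ⟨i, _, e⟩ => hFo' i e
            have hFs : F ≠ s := by
              rcases hs with rfl | rfl
              · exact hFv
              · exact hFo' k
            simp only [hFc, hFs, or_self, hFv, false_and, hno, false_iff, not_not] at hx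
            simp only [hFc, hni, or_self, iff_false]
            exact hx.1
  -- coreEnd and coreCompl
  have hend : coreEnd v S k = s := by
    unfold coreEnd
    split_ifs with h
    · exact (hSk.1 h).symm
    · exact (hs.resolve_right fun e => h (hSk.2 e)).symm
  have hcompl : coreCompl v S k ζ = ξ := by
    unfold coreCompl
    rw [hSerase, ← hdec]
  refine ⟨(S, ζ), ⟨hcore, hend, hcompl⟩, ?_⟩
  -- uniqueness
  rintro ⟨S', ζ'⟩ ⟨hcore', hend', hcompl'⟩
  obtain ⟨-, hside'⟩ := ha_core_sub D hcore'
  have hζ' : ζ' = ζ := by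
    ext b
    rw [hζmem]
    constructor
    · intro hb
      refine ⟨?_, fun j e => hside' j (e ▸ hb)⟩
      rw [← hcompl']; unfold coreCompl; exact Finset.mem_union_left _ hb
    · rintro ⟨hbξ, hbside⟩
      rw [← hcompl'] at hbξ
      unfold coreCompl at hbξ
      rcases Finset.mem_union.1 hbξ with h | h
      · exact h
      · obtain ⟨j, -, rfl⟩ := Finset.mem_image.1 h
        exact absurd rfl (hbside j)
  have hS' : S' = S := by
    ext i
    by_cases hik : i = k
    · subst hik
      rw [hSk]
      unfold coreEnd at hend'
      split_ifs at hend' with h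
      · exact ⟨fun _ => hend'.symm, fun _ => h⟩
      · exact ⟨fun h' => absurd h' h, fun e => absurd (hend'.trans e) (hvo i)⟩
    · rw [hSi i hik]
      constructor
      · intro hi
        rw [← hcompl']; unfold coreCompl
        exact Finset.mem_union_right _ (Finset.mem_image.2 ⟨i, Finset.mem_erase.2 ⟨hik, hi⟩, rfl⟩)
      · intro hi
        rw [← hcompl'] at hi
        unfold coreCompl at hi
        rcases Finset.mem_union.1 hi with h | h
        · exact absurd h (hside' i)
        · obtain ⟨i', hi', e⟩ := Finset.mem_image.1 h
          have := side_injective v e; subst this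
          exact (Finset.mem_erase.1 hi').2
  simp only [Prod.mk.injEq]
  exact ⟨hS', hζ'⟩

open Classical in
/-- **HT1 `CoreDecomposition` holds.** [cite: KhristoforovSmirnov2021, Lemma 4 (discrete holomorphicity: the triple bijection at a vertex)] -/
theorem coreDecomposition_holds : CoreDecomposition D := by
  intro v hv k
  exact ⟨fun S ζ hq => h1_compl_mem D hv k S ζ hq, fun s hs ξ hξ => h1_exists_unique D hv k hs hξ⟩


end N5

end Literature.Probability.Percolation.FivePoint


/-! # ═══════════════════════ HT2 `InvariantTriples` ∀ D (pcv-sawmu b-engine-2 gen 6) ═══════════════════════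

Max-degree-two bookkeeping, no planarity. The completion `coreCompl v S k ζ = ζ ∪ {side v i : i ∈ S, i ≠ k}` ATTACHES the isolated
interior face `v` to the core through the added sides: a walk in the completion either avoids `v`, or enters and leaves `v` across two
attached sides (`ht2_reach_attach`). Under the HT2 hypothesis (one odd neighbour, or two odd neighbours linked to each other in the
core) the two linking data read by `InClass` — «the odd endpoint is linked to `y_r`» and «`y_{r+1}` is linked to `y_{r+2}` / `y_{r+4}`» —
coincide for the three completions (`ht2_end_link_iff`, `ht2_corner_link_iff`), because a path component of a core carries at most two
odd faces (`odd_component`): two odd neighbours linked to each other are blind to every corner (`ht2_blind`). The support/parity half of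
`InClass` holds for EVERY completion of EVERY core (`ht2_coreCompl_mem_T6at`, = HT1 clause (1)). Final: `invariantTriples_holds`. -/

namespace Literature.Probability.Percolation.FivePoint

open Finset Literature.Probability.Percolation Literature.Probability.LatticeModels Literature.Probability.Percolation.FivePoint TriMarkedDomain

variable (D : TriMarkedDomain 5)

namespace N5

/-! #### HT2-0. The interior face `v`: sides, neighbours, corners -/

/-- `InClass` unfolded: support, parity profile, the link of `s` to `y_j`, the pattern. [cite: KhristoforovSmirnov2021, §1.2 (loop configurations, pp. 3–4)] -/
theorem ht2_inClass_iff (u w : Site 2) (s : HexVertex) (j : Fin 5) (m : Bool) (A : Finset (Sym2 (Site 2))) :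
    InClass D u w s j m A ↔
      A ⊆ (hBonds D).erase s(u, w) ∧ ParityIs D A (insert s (corners D)) ∧ (sideGraph A).Reachable s (yc D j) ∧ patm D j m A := by
  classical
  rw [← c_mem_filter_inClass_iff, Finset.mem_filter]
  exact ⟨fun h => ⟨h.1, h⟩, fun h => h.2⟩

/-- membership in the six-odd-point space at the `k`-th edge of `v`, unfolded. [cite: KhristoforovSmirnov2021, §1.2 (loop configurations, pp. 3–4)] -/
theorem ht2_mem_T6at_iff (v : HexVertex) (k : Fin 3) (s : HexVertex) (A : Finset (Sym2 (Site 2))) :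
    A ∈ T6at D v k s ↔ A ⊆ (hBonds D).erase (side v k) ∧ ParityIs D A (insert s (corners D)) := by
  classical
  unfold T6at loopSpace6 ParityIs
  rw [Finset.mem_filter, Finset.mem_powerset]
  refine and_congr Iff.rfl (forall₂_congr fun F _ => ?_)
  rw [c_mem_insert_corners_iff]

/-- two consecutive labelled vertices of a face are distinct. [cite: BollobasRiordan2006, Ch. 7 §7.2.2 pp. 168–171] -/
theorem ht2_fv_ne (v : HexVertex) (k : Fin 3) : faceVertex v (k + 1) ≠ faceVertex v (k + 2) := by
  have h := faceVertex_add_ne v (k + 1) (k := 1) (by decide)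
  rw [fin3_add_one_add_one] at h
  exact h.symm

/-- the sides of an interior face are `H_G`-bonds. [cite: BollobasRiordan2006, Ch. 7 §7.2.2 pp. 168–171] -/
theorem ht2_side_mem_hBonds {v : HexVertex} (hv : hexFaceVertices v ⊆ D.verts) (k : Fin 3) : side v k ∈ hBonds D := by
  have hadj := adj_faceVertex_succ v (k + 1)
  rw [fin3_add_one_add_one] at hadj
  exact mem_hBonds D hadj (Or.inl (hv (faceVertex_mem v _)))

/-- an interior face touches `G`. [cite: BollobasRiordan2006, Ch. 7 §7.2.2 pp. 168–171] -/
theorem ht2_v_touching {v : HexVertex} (hv : hexFaceVertices v ⊆ D.verts) : v ∈ triFacesTouching D.verts :=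
  mem_triFacesTouching.2 ⟨faceVertex v 0, hv (faceVertex_mem v 0), faceVertex_mem v 0⟩

/-- the neighbours of an interior face touch `G`. [cite: BollobasRiordan2006, Ch. 7 §7.2.2 pp. 168–171] -/
theorem ht2_opp_touching {v : HexVertex} (hv : hexFaceVertices v ⊆ D.verts) (k : Fin 3) :
    oppFace v k ∈ triFacesTouching D.verts :=
  mem_touching_of_side_mem D (j := oppIdx v k) (by rw [side_oppFace_oppIdx]; exact ht2_side_mem_hBonds D hv k)

/-- an interior face is not a corner face. [cite: BollobasRiordan2006, Ch. 7 §7.2.2 pp. 168–171] -/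
theorem ht2_v_not_corner {v : HexVertex} (hv : hexFaceVertices v ⊆ D.verts) : v ∉ corners D :=
  (not_mem_corners_iff D).2 fun i =>
    not_corner_of_two_mem D (faceVertex_mem v (0 + 1)) (faceVertex_mem v (0 + 2)) (hv (faceVertex_mem v _))
      (hv (faceVertex_mem v _)) (ht2_fv_ne v 0) i

/-- a neighbour of an interior face is not a corner face (two of its vertices lie in `G`). [cite: BollobasRiordan2006, Ch. 7 §7.2.2 pp. 168–171] -/
theorem ht2_opp_not_corner {v : HexVertex} (hv : hexFaceVertices v ⊆ D.verts) (k : Fin 3) : oppFace v k ∉ corners D := by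
  have h1 : faceVertex v (k + 1) ∈ hexFaceVertices (oppFace v k) := by
    rw [← faceVertex_oppFace_succ_succ]; exact faceVertex_mem _ _
  have h2 : faceVertex v (k + 2) ∈ hexFaceVertices (oppFace v k) := by
    rw [← faceVertex_oppFace_succ]; exact faceVertex_mem _ _
  exact (not_mem_corners_iff D).2 fun i =>
    not_corner_of_two_mem D h1 h2 (hv (faceVertex_mem v _)) (hv (faceVertex_mem v _)) (ht2_fv_ne v k) i

/-- a corner face is not the interior face `v`. [cite: BollobasRiordan2006, Ch. 7 §7.2.2 pp. 168–171] -/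
theorem ht2_yc_ne_v {v : HexVertex} (hv : hexFaceVertices v ⊆ D.verts) (a : Fin 5) : yc D a ≠ v := fun e =>
  ht2_v_not_corner D hv (by rw [← e]; exact yc_mem_corners D a)

/-- a corner face is not a neighbour of the interior face `v`. [cite: BollobasRiordan2006, Ch. 7 §7.2.2 pp. 168–171] -/
theorem ht2_opp_ne_yc {v : HexVertex} (hv : hexFaceVertices v ⊆ D.verts) (k : Fin 3) (a : Fin 5) : oppFace v k ≠ yc D a := fun e =>
  ht2_opp_not_corner D hv k (by rw [e]; exact yc_mem_corners D a)

/-! #### HT2-1. Cores: the face `v` is isolated; odd faces; no third odd face in a component -/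

/-- `v` is isolated in a core: nothing else is reachable from it. [cite: KhristoforovSmirnov2021, Lemma 4 (discrete holomorphicity: the triple bijection at a vertex)] -/
theorem ht2_reach_v {v : HexVertex} {S : Finset (Fin 3)} {ζ : Finset (Sym2 (Site 2))} (hq : IsCore D v S ζ) {F : HexVertex}
    (h : (sideGraph ζ).Reachable v F) : F = v := by
  rw [SimpleGraph.reachable_iff_reflTransGen] at h
  induction h with
  | refl => rfl
  | tail _ hbc ih =>
    subst ih
    obtain ⟨j, -, hj⟩ := hbc
    exact absurd hj ((ha_core_sub D hq).2 j)

/-- the odd neighbours of a core are odd. [cite: KhristoforovSmirnov2021, Lemma 4 (discrete holomorphicity: the triple bijection at a vertex)] -/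
theorem ht2_odd_opp {v : HexVertex} (hv : hexFaceVertices v ⊆ D.verts) {S : Finset (Fin 3)} {ζ : Finset (Sym2 (Site 2))}
    (hq : IsCore D v S ζ) {i : Fin 3} (hi : i ∈ S) : Odd (xiDeg ζ (oppFace v i)) :=
  (hq.2.2 _ (ht2_opp_touching D hv i)).2 (Finset.mem_union_right _ (Finset.mem_image.2 ⟨i, hi, rfl⟩))

/-- the corners are odd in a core. [cite: KhristoforovSmirnov2021, Lemma 4 (discrete holomorphicity: the triple bijection at a vertex)] -/
theorem ht2_odd_yc {v : HexVertex} {S : Finset (Fin 3)} {ζ : Finset (Sym2 (Site 2))} (hq : IsCore D v S ζ) (a : Fin 5) :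
    Odd (xiDeg ζ (yc D a)) :=
  (hq.2.2 _ (yc_mem_touching D a)).2 (Finset.mem_union_left _ (yc_mem_corners D a))

/-- **no three odd faces in a component of a core** (`odd_component`). [cite: KhristoforovSmirnov2021, Lemma 4 (discrete holomorphicity: the triple bijection at a vertex)] -/
theorem ht2_no_three {v : HexVertex} {S : Finset (Fin 3)} {ζ : Finset (Sym2 (Site 2))} (hq : IsCore D v S ζ) {Y₁ Y₂ Y₃ : HexVertex}
    (h1 : Y₁ ∈ triFacesTouching D.verts) (o1 : Odd (xiDeg ζ Y₁)) (o2 : Odd (xiDeg ζ Y₂)) (o3 : Odd (xiDeg ζ Y₃))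
    (r12 : (sideGraph ζ).Reachable Y₁ Y₂) (r13 : (sideGraph ζ).Reachable Y₁ Y₃) (n12 : Y₁ ≠ Y₂) (n13 : Y₁ ≠ Y₃) (n23 : Y₂ ≠ Y₃) :
    False :=
  n23 ((odd_component D (ha_core_sub D hq).1 (ha_core_deg_le_two D hq) h1 o1).2 Y₂ Y₃ r12 r13 o2 o3 n12.symm n13.symm)

/-- **blindness**: two odd neighbours linked to each other in a core are linked to no corner. [cite: KhristoforovSmirnov2021, Lemma 4 (discrete holomorphicity: the triple bijection at a vertex)] -/
theorem ht2_blind {v : HexVertex} (hv : hexFaceVertices v ⊆ D.verts) {S : Finset (Fin 3)} {ζ : Finset (Sym2 (Site 2))}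
    (hq : IsCore D v S ζ) {i₀ i₁ : Fin 3} (h0 : i₀ ∈ S) (h1 : i₁ ∈ S) (hne : i₀ ≠ i₁)
    (hl : (sideGraph ζ).Reachable (oppFace v i₀) (oppFace v i₁)) (a : Fin 5) :
    ¬ (sideGraph ζ).Reachable (oppFace v i₀) (yc D a) ∧ ¬ (sideGraph ζ).Reachable (oppFace v i₁) (yc D a) := by
  have o0 := ht2_odd_opp D hv hq h0
  have o1 := ht2_odd_opp D hv hq h1
  have oa := ht2_odd_yc D hq a
  have n01 : oppFace v i₀ ≠ oppFace v i₁ := fun e => hne (oppFace_injective' v e)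
  have n0a := ht2_opp_ne_yc D hv i₀ a
  have n1a := ht2_opp_ne_yc D hv i₁ a
  have ht := ht2_opp_touching D hv i₀
  exact ⟨fun hr => ht2_no_three D hq ht o0 o1 oa hl hr n01 n0a n1a,
    fun hr => ht2_no_three D hq ht o0 o1 oa hl (hl.trans hr) n01 n0a n1a⟩

/-- pigeonhole in `Fin 3`: two indices avoiding a pair of distinct indices coincide. [cite: BollobasRiordan2006, Ch. 7 §7.2.2 pp. 168–171] -/
private theorem ht2_fin3_third {i₀ i₁ i i' : Fin 3} (h : i₀ ≠ i₁) (hi : i ≠ i₀) (hi1 : i ≠ i₁) (hi' : i' ≠ i₀) (hi'1 : i' ≠ i₁) :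
    i = i' := by
  revert i₀ i₁ i i'; decide

/-- pigeonhole in `Fin 3`: an index other than the third one is one of the pair. [cite: BollobasRiordan2006, Ch. 7 §7.2.2 pp. 168–171] -/
private theorem ht2_fin3_or {i₀ i₁ i₃ k : Fin 3} (h : i₀ ≠ i₁) (h0 : i₃ ≠ i₀) (h1 : i₃ ≠ i₁) (hk : k ≠ i₃) : k = i₀ ∨ k = i₁ := by
  revert i₀ i₁ i₃ k; decide

/-! #### HT2-2. Attaching the isolated face `v` through some of its sides -/

/-- the side graph is monotone in the edge set. [cite: KhristoforovSmirnov2021, §1.2 (loop configurations, pp. 3–4)] -/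
theorem ht2_sideGraph_mono {A B : Finset (Sym2 (Site 2))} (h : A ⊆ B) : sideGraph A ≤ sideGraph B := by
  intro F F' hFF'
  obtain ⟨j, h1, h2⟩ := hFF'
  exact ⟨j, h1, h h2⟩

/-- **attachment lemma**: reachability from `Y ≠ v` in `A ∪ {side v i : i ∈ T}`, where no side of the interior face `v` lies in `A`:
a face `F ≠ v` is reached either inside `A`, or through `v`, entering and leaving across two attached sides; `v` itself is reached
exactly through an attached neighbour. [cite: KhristoforovSmirnov2021, Lemma 4 (discrete holomorphicity: the triple bijection at a vertex)] -/
theorem ht2_reach_attach {v : HexVertex} (hv : hexFaceVertices v ⊆ D.verts) {A : Finset (Sym2 (Site 2))}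
    (hAv : ∀ j : Fin 3, side v j ∉ A) (T : Finset (Fin 3)) {Y : HexVertex} (hY : Y ≠ v) (F : HexVertex) :
    (sideGraph (A ∪ T.image (side v))).Reachable Y F ↔
      (F ≠ v ∧ ((sideGraph A).Reachable Y F ∨
        ∃ i ∈ T, ∃ i' ∈ T, (sideGraph A).Reachable Y (oppFace v i) ∧ (sideGraph A).Reachable (oppFace v i') F)) ∨
      (F = v ∧ ∃ i ∈ T, (sideGraph A).Reachable Y (oppFace v i)) := by
  classical
  -- one-step facts
  have hvi : ∀ i ∈ T, (sideGraph (A ∪ T.image (side v))).Adj v (oppFace v i) := fun i hi =>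
    ⟨i, rfl, Finset.mem_union_right _ (Finset.mem_image.2 ⟨i, hi, rfl⟩)⟩
  have hle : sideGraph A ≤ sideGraph (A ∪ T.image (side v)) := ht2_sideGraph_mono Finset.subset_union_left
  constructor
  · intro h
    rw [SimpleGraph.reachable_iff_reflTransGen] at h
    induction h with
    | refl => exact Or.inl ⟨hY, Or.inl SimpleGraph.Reachable.rfl⟩
    | @tail b c _ hbc ih =>
      obtain ⟨j, hc, hj⟩ := hbc
      rcases ih with ⟨hbv, hb⟩ | ⟨hbv, i, hi, hri⟩
      · -- `b ≠ v`
        rcases Finset.mem_union.1 hj with hjA | hjX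
        · -- an `A`-step; its endpoint is not `v`
          have hcv : c ≠ v := by
            intro hcv
            rw [hcv] at hc
            have hs : side v (oppIdx b j) = side b j := by rw [hc, side_oppFace_oppIdx]
            exact hAv (oppIdx b j) (hs ▸ hjA)
          have hstep : (sideGraph A).Adj b c := ⟨j, hc, hjA⟩
          refine Or.inl ⟨hcv, ?_⟩
          rcases hb with hb | ⟨i, hi, i', hi', h1, h2⟩
          · exact Or.inl (hb.trans hstep.reachable)
          · exact Or.inr ⟨i, hi, i', hi', h1, h2.trans hstep.reachable⟩
        · -- an attached side: `b = oppFace v i` and `c = v`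
          obtain ⟨i, hiT, hside⟩ := Finset.mem_image.1 hjX
          have hbt : b ∈ triFacesTouching D.verts := mem_touching_of_side_mem D (hside ▸ ht2_side_mem_hBonds D hv i)
          rcases (l3_exists_side_eq_iff D (ht2_side_mem_hBonds D hv i) hbt).1 ⟨j, hside.symm⟩ with hb1 | hb1
          · exact absurd hb1 hbv
          · have hjidx : j = oppIdx v i := by
              rw [hb1, ← side_oppFace_oppIdx v i] at hside
              exact (side_injective _ hside).symm
            have hcv : c = v := by rw [hc, hb1, hjidx, oppFace_oppFace]
            refine Or.inr ⟨hcv, ?_⟩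
            rcases hb with hb | ⟨i₁, hi₁, i', -, h1, -⟩
            · exact ⟨i, hiT, hb1 ▸ hb⟩
            · exact ⟨i₁, hi₁, h1⟩
      · -- `b = v`: the step leaves across an attached side
        rw [hbv] at hc hj
        have hjT : j ∈ T := by
          rcases Finset.mem_union.1 hj with hjA | hjX
          · exact absurd hjA (hAv j)
          · obtain ⟨i', hi', he⟩ := Finset.mem_image.1 hjX
            rw [← side_injective _ he]; exact hi'
        have hcv : c ≠ v := by rw [hc]; exact (hexGraph_adj_oppFace _ j).ne.symm
        exact Or.inl ⟨hcv, Or.inr ⟨i, hi, j, hjT, hri, by rw [hc]⟩⟩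
  · rintro (⟨-, h | ⟨i, hi, i', hi', h1, h2⟩⟩ | ⟨hFv, i, hi, h⟩)
    · exact h.mono hle
    · have s1 : (sideGraph (A ∪ T.image (side v))).Adj (oppFace v i) v := (hvi i hi).symm
      have s2 : (sideGraph (A ∪ T.image (side v))).Adj v (oppFace v i') := hvi i' hi'
      exact (((h1.mono hle).trans s1.reachable).trans s2.reachable).trans (h2.mono hle)
    · subst hFv
      exact (h.mono hle).trans (hvi i hi).symm.reachable

/-! #### HT2-3. The linking data of the completions under the HT2 hypothesis -/

/-- **corner-to-corner links are the same in every completion as in the core** (HT2 hypothesis). [cite: KhristoforovSmirnov2021, Lemma 4 (discrete holomorphicity: the triple bijection at a vertex)] -/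
theorem ht2_corner_link_iff {v : HexVertex} (hv : hexFaceVertices v ⊆ D.verts) {S : Finset (Fin 3)} {ζ : Finset (Sym2 (Site 2))}
    (hq : IsCore D v S ζ) (hinv : S.card = 1 ∨ ∃ i ∈ S, ∃ i' ∈ S, i ≠ i' ∧ XiLinked ζ (oppFace v i) (oppFace v i'))
    (k : Fin 3) (a b : Fin 5) :
    (sideGraph (coreCompl v S k ζ)).Reachable (yc D a) (yc D b) ↔ (sideGraph ζ).Reachable (yc D a) (yc D b) := by
  obtain ⟨-, hside⟩ := ha_core_sub D hq
  have hav := ht2_yc_ne_v D hv a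
  have hbv := ht2_yc_ne_v D hv b
  unfold coreCompl
  rw [ht2_reach_attach D hv hside (S.erase k) hav]
  constructor
  · rintro (⟨-, h | ⟨i, hi, i', hi', h1, h2⟩⟩ | ⟨h, -⟩)
    · exact h
    · have hii' : i = i' := by
        rcases hinv with hc | ⟨i₀, h0, i₁, h1', hne, hl⟩
        · exact Finset.card_le_one.1 hc.le i (Finset.mem_of_mem_erase hi) i' (Finset.mem_of_mem_erase hi')
        · rw [xiLinked_iff_reachable] at hl
          have hi0 : i ≠ i₀ := fun e => (ht2_blind D hv hq h0 h1' hne hl a).1 (by rw [← e]; exact h1.symm)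
          have hi1 : i ≠ i₁ := fun e => (ht2_blind D hv hq h0 h1' hne hl a).2 (by rw [← e]; exact h1.symm)
          have hi'0 : i' ≠ i₀ := fun e => (ht2_blind D hv hq h0 h1' hne hl b).1 (by rw [← e]; exact h2)
          have hi'1 : i' ≠ i₁ := fun e => (ht2_blind D hv hq h0 h1' hne hl b).2 (by rw [← e]; exact h2)
          exact ht2_fin3_third hne hi0 hi1 hi'0 hi'1
      subst hii'
      exact h1.trans h2
    · exact absurd h hbv
  · intro h
    exact Or.inl ⟨hbv, Or.inl h⟩

/-- **the odd endpoint of every completion is linked to `y_a` iff some odd neighbour is linked to `y_a` in the core** (HT2 hypothesis). [cite: KhristoforovSmirnov2021, Lemma 4 (discrete holomorphicity: the triple bijection at a vertex)] -/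
theorem ht2_end_link_iff {v : HexVertex} (hv : hexFaceVertices v ⊆ D.verts) {S : Finset (Fin 3)} {ζ : Finset (Sym2 (Site 2))}
    (hq : IsCore D v S ζ) (hinv : S.card = 1 ∨ ∃ i ∈ S, ∃ i' ∈ S, i ≠ i' ∧ XiLinked ζ (oppFace v i) (oppFace v i'))
    (k : Fin 3) (a : Fin 5) :
    (sideGraph (coreCompl v S k ζ)).Reachable (coreEnd v S k) (yc D a) ↔
      ∃ i ∈ S, (sideGraph ζ).Reachable (oppFace v i) (yc D a) := by
  obtain ⟨-, hside⟩ := ha_core_sub D hq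
  have hav := ht2_yc_ne_v D hv a
  unfold coreCompl coreEnd
  split_ifs with hk
  · -- `k ∈ S`: the endpoint is the neighbour `oppFace v k`
    have hkv : oppFace v k ≠ v := (hexGraph_adj_oppFace v k).ne.symm
    rw [ht2_reach_attach D hv hside (S.erase k) hkv]
    constructor
    · rintro (⟨-, h | ⟨i, -, i', hi', -, h2⟩⟩ | ⟨h, -⟩)
      · exact ⟨k, hk, h⟩
      · exact ⟨i', Finset.mem_of_mem_erase hi', h2⟩
      · exact absurd h hav
    · rintro ⟨i₃, hi₃, h3⟩
      by_cases e : i₃ = k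
      · subst e
        exact Or.inl ⟨hav, Or.inl h3⟩
      · rcases hinv with hc | ⟨i₀, h0, i₁, h1, hne, hl⟩
        · exact absurd (Finset.card_le_one.1 hc.le i₃ hi₃ k hk) e
        · rw [xiLinked_iff_reachable] at hl
          have hb := ht2_blind D hv hq h0 h1 hne hl a
          have h30 : i₃ ≠ i₀ := fun e' => hb.1 (by rw [← e']; exact h3)
          have h31 : i₃ ≠ i₁ := fun e' => hb.2 (by rw [← e']; exact h3)
          refine Or.inl ⟨hav, Or.inr ?_⟩
          rcases ht2_fin3_or hne h30 h31 (fun h => e h.symm) with rfl | rfl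
          · exact ⟨i₁, Finset.mem_erase.2 ⟨hne.symm, h1⟩, i₃, Finset.mem_erase.2 ⟨e, hi₃⟩, hl, h3⟩
          · exact ⟨i₀, Finset.mem_erase.2 ⟨hne, h0⟩, i₃, Finset.mem_erase.2 ⟨e, hi₃⟩, hl.symm, h3⟩
  · -- `k ∉ S`: the endpoint is `v`
    rw [Finset.erase_eq_self.2 hk, SimpleGraph.reachable_comm, ht2_reach_attach D hv hside S hav]
    constructor
    · rintro (⟨h, -⟩ | ⟨-, i, hi, h⟩)
      · exact absurd rfl h
      · exact ⟨i, hi, h.symm⟩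
    · rintro ⟨i, hi, h⟩
      exact Or.inr ⟨rfl, i, hi, h.symm⟩

/-! #### HT2-4. Support and parity of a completion (HT1 clause (1)) -/

/-- `¬ q` turns `¬ (a ↔ q)` into `a`. [cite: BollobasRiordan2006, Ch. 7 §7.2.2 pp. 168–171] -/
theorem ht2_not_iff_of_not {a q : Prop} (hq : ¬ q) : (¬ (a ↔ q) ↔ a) := by tauto

/-- which faces other than `v` see an odd number of attached sides: exactly the attached neighbours. [cite: KhristoforovSmirnov2021, Lemma 4 (discrete holomorphicity: the triple bijection at a vertex)] -/
theorem ht2_odd_xiDeg_image_iff {v : HexVertex} (hv : hexFaceVertices v ⊆ D.verts) (T : Finset (Fin 3)) {F : HexVertex}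
    (hF : F ∈ triFacesTouching D.verts) (hFv : F ≠ v) :
    Odd (xiDeg (T.image (side v)) F) ↔ ∃ i ∈ T, F = oppFace v i := by
  classical
  rw [l1_xiDeg_eq]
  by_cases h : ∃ i ∈ T, F = oppFace v i
  · obtain ⟨i, hi, rfl⟩ := h
    have hf : ((Finset.univ : Finset (Fin 3)).filter fun j => side (oppFace v i) j ∈ T.image (side v)) = {oppIdx v i} := by
      ext j
      simp only [Finset.mem_filter, Finset.mem_univ, true_and, Finset.mem_singleton, Finset.mem_image]
      constructor
      · rintro ⟨i', _, he⟩
        rcases (l3_exists_side_eq_iff D (ht2_side_mem_hBonds D hv i') (ht2_opp_touching D hv i)).1 ⟨j, he.symm⟩ with h1 | h1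
        · exact absurd h1 (hexGraph_adj_oppFace v i).ne.symm
        · have hii' : i = i' := oppFace_injective' v h1
          subst hii'
          rw [← side_oppFace_oppIdx v i] at he
          exact (side_injective _ he).symm
      · rintro rfl
        exact ⟨i, hi, (side_oppFace_oppIdx v i).symm⟩
    rw [hf, Finset.card_singleton]
    exact ⟨fun _ => ⟨i, hi, rfl⟩, fun _ => odd_one⟩
  · have hf : ((Finset.univ : Finset (Fin 3)).filter fun j => side F j ∈ T.image (side v)) = ∅ := by
      rw [Finset.filter_eq_empty_iff]
      intro j _ hj
      obtain ⟨i', hi', he⟩ := Finset.mem_image.1 hj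
      rcases (l3_exists_side_eq_iff D (ht2_side_mem_hBonds D hv i') hF).1 ⟨j, he.symm⟩ with h1 | h1
      · exact hFv h1
      · exact h ⟨i', hi', h1⟩
    rw [hf, Finset.card_empty]
    exact ⟨fun ho => absurd ho (by decide), fun he => absurd he h⟩

/-- `v` sees all the attached sides. [cite: KhristoforovSmirnov2021, Lemma 4 (discrete holomorphicity: the triple bijection at a vertex)] -/
theorem ht2_xiDeg_image_v (v : HexVertex) (T : Finset (Fin 3)) : xiDeg (T.image (side v)) v = #T := by
  classical
  rw [l1_xiDeg_eq]
  congr 1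
  ext j
  simp only [Finset.mem_filter, Finset.mem_univ, true_and, Finset.mem_image]
  constructor
  · rintro ⟨i, hi, he⟩
    rw [← side_injective v he]; exact hi
  · intro hj
    exact ⟨j, hj, rfl⟩

/-- attaching sides of `v` to a set avoiding them is a symmetric difference. [cite: KhristoforovSmirnov2021, §1.2 (loop configurations, pp. 3–4)] -/
theorem ht2_union_eq_symmDiff {v : HexVertex} {A : Finset (Sym2 (Site 2))} (hAv : ∀ j : Fin 3, side v j ∉ A) (T : Finset (Fin 3)) :
    A ∪ T.image (side v) = symmDiff A (T.image (side v)) := by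
  ext e
  rw [Finset.mem_union, Finset.mem_symmDiff]
  constructor
  · rintro (h | h)
    · refine Or.inl ⟨h, fun h' => ?_⟩
      obtain ⟨i, -, rfl⟩ := Finset.mem_image.1 h'
      exact hAv i h
    · refine Or.inr ⟨h, fun h' => ?_⟩
      obtain ⟨i, -, rfl⟩ := Finset.mem_image.1 h
      exact hAv i h'
  · rintro (⟨h, -⟩ | ⟨h, -⟩)
    · exact Or.inl h
    · exact Or.inr h

/-- **HT1 clause (1)**: every completion of a core lies in the six-odd-point space at its edge, with odd endpoint `coreEnd`
(support: the core avoids the sides of `v`, the attached sides avoid `side v k`; parity: `XorDeg` plus the side counts of the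
attached sides). [cite: KhristoforovSmirnov2021, Lemma 4 (discrete holomorphicity: the triple bijection at a vertex)] -/
theorem ht2_coreCompl_mem_T6at {v : HexVertex} (hv : hexFaceVertices v ⊆ D.verts) {S : Finset (Fin 3)} {ζ : Finset (Sym2 (Site 2))}
    (hq : IsCore D v S ζ) (k : Fin 3) : coreCompl v S k ζ ∈ T6at D v k (coreEnd v S k) := by
  classical
  obtain ⟨hζ, hside⟩ := ha_core_sub D hq
  have hpar := hq.2.2
  rw [ht2_mem_T6at_iff]
  constructor
  · -- support
    intro e he
    unfold coreCompl at he
    rw [Finset.mem_erase]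
    rcases Finset.mem_union.1 he with h | h
    · exact ⟨fun e' => hside k (e' ▸ h), hζ h⟩
    · obtain ⟨i, hi, rfl⟩ := Finset.mem_image.1 h
      exact ⟨fun e' => (Finset.mem_erase.1 hi).1 (side_injective v e'), ht2_side_mem_hBonds D hv i⟩
  · -- parity
    intro F hF
    unfold coreCompl
    rw [ht2_union_eq_symmDiff hside, xorDeg_holds, hpar F hF, Finset.mem_insert]
    have hvnc := ht2_v_not_corner D hv
    by_cases hFv : F = v
    · rw [hFv, ht2_xiDeg_image_v]
      have hnot : ¬ v ∈ corners D ∪ S.image (oppFace v) := by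
        rw [Finset.mem_union, not_or]
        refine ⟨hvnc, fun h => ?_⟩
        obtain ⟨i, -, he⟩ := Finset.mem_image.1 h
        exact (hexGraph_adj_oppFace v i).ne he.symm
      unfold coreEnd
      split_ifs with hk
      · have hev : ¬ Odd #(S.erase k) := by
          rw [Finset.card_erase_of_mem hk]
          obtain ⟨m, hm⟩ := hq.2.1
          rw [hm]
          rintro ⟨m', hm'⟩
          omega
        have hne : v ≠ oppFace v k := (hexGraph_adj_oppFace v k).ne
        tauto
      · rw [Finset.erase_eq_self.2 hk]
        have hodd : Odd #S := hq.2.1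
        have hvv : v = v ∨ v ∈ corners D := Or.inl rfl
        tauto
    · rw [ht2_odd_xiDeg_image_iff D hv (S.erase k) hF hFv]
      by_cases hFo : ∃ i ∈ S.erase k, F = oppFace v i
      · obtain ⟨i, hi, rfl⟩ := hFo
        have hik : i ≠ k := (Finset.mem_erase.1 hi).1
        have hiS : i ∈ S := (Finset.mem_erase.1 hi).2
        have hin : oppFace v i ∈ corners D ∪ S.image (oppFace v) :=
          Finset.mem_union_right _ (Finset.mem_image.2 ⟨i, hiS, rfl⟩)
        have hnc := ht2_opp_not_corner D hv i
        have hne : oppFace v i ≠ coreEnd v S k := by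
          unfold coreEnd
          split_ifs with hk
          · exact fun e => hik (oppFace_injective' v e)
          · exact (hexGraph_adj_oppFace v i).ne.symm
        have hyes : ∃ i' ∈ S.erase k, oppFace v i = oppFace v i' := ⟨i, hi, rfl⟩
        have hl : (oppFace v i ∈ corners D ∪ S.image (oppFace v) ↔ ∃ i' ∈ S.erase k, oppFace v i = oppFace v i') :=
          iff_of_true hin hyes
        constructor
        · intro h; exact absurd hl h
        · rintro (h | h)
          · exact absurd h hne
          · exact absurd h hnc
      · have himg : F ∈ S.image (oppFace v) ↔ (k ∈ S ∧ F = oppFace v k) := by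
          rw [Finset.mem_image]
          constructor
          · rintro ⟨i, hiS, rfl⟩
            by_cases hik : i = k
            · subst hik; exact ⟨hiS, rfl⟩
            · exact absurd ⟨i, Finset.mem_erase.2 ⟨hik, hiS⟩, rfl⟩ hFo
          · rintro ⟨hk, rfl⟩; exact ⟨k, hk, rfl⟩
        rw [Finset.mem_union, himg, ht2_not_iff_of_not hFo]
        unfold coreEnd
        split_ifs with hk
        · constructor
          · rintro (h | ⟨-, h⟩)
            · exact Or.inr h
            · exact Or.inl h
          · rintro (h | h)
            · exact Or.inr ⟨hk, h⟩
            · exact Or.inl h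
        · constructor
          · rintro (h | ⟨h, -⟩)
            · exact Or.inr h
            · exact absurd h hk
          · rintro (h | h)
            · exact absurd h hFv
            · exact Or.inl h

/-! #### HT2-5. The class of a completion, and HT2 -/

/-- **the class of every completion, read in the core** (HT2 hypothesis): `(r, M)` with `y_r` linked to an odd neighbour and the
pattern `M` of the core. [cite: KhristoforovSmirnov2021, Lemma 4 (discrete holomorphicity: the triple bijection at a vertex)] -/
theorem ht2_complClass_iff {v : HexVertex} (hv : hexFaceVertices v ⊆ D.verts) {S : Finset (Fin 3)} {ζ : Finset (Sym2 (Site 2))}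
    (hq : IsCore D v S ζ) (hinv : S.card = 1 ∨ ∃ i ∈ S, ∃ i' ∈ S, i ≠ i' ∧ XiLinked ζ (oppFace v i) (oppFace v i'))
    (k : Fin 3) (r : Fin 5) (m : Bool) :
    ComplClass D v S k ζ r m ↔ (∃ i ∈ S, (sideGraph ζ).Reachable (oppFace v i) (yc D r)) ∧ patm D r m ζ := by
  have hmem := ht2_coreCompl_mem_T6at D hv hq k
  rw [ht2_mem_T6at_iff] at hmem
  unfold ComplClass
  rw [ht2_inClass_iff, ht2_end_link_iff D hv hq hinv k r]
  unfold patm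
  rw [xiLinked_iff_reachable, xiLinked_iff_reachable, ht2_corner_link_iff D hv hq hinv k]
  exact ⟨fun h => ⟨h.2.2.1, h.2.2.2⟩, fun h => ⟨hmem.1, hmem.2, h.1, h.2⟩⟩

/-- **HT2 `InvariantTriples` holds for every five-marked domain**: a core with one odd neighbour, or with two odd neighbours linked
to each other, has three completions of the same class. [cite: KhristoforovSmirnov2021, Lemma 4 (discrete holomorphicity: the triple bijection at a vertex)] -/
theorem invariantTriples_holds : InvariantTriples D := by
  intro v hv S ζ hq hinv k k' r m
  rw [ht2_complClass_iff D hv hq hinv k r m, ht2_complClass_iff D hv hq hinv k' r m]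

end N5

end Literature.Probability.Percolation.FivePoint
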